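import Summits.BirchSwinnertonDyer.BirchSwinnertonDyer.Theorems.AlignedTransportAtTwoMainConjectureOfRankZeroBSDAtTwoCubicKilfordPrimes
import Literature.NumberTheory.IwasawaTheory.NarrowFukudaRankMonotone
import HarnessLib

/-!
# Route `AlignedTransportAtTwo`, crux C2 `MainConjectureOfRankZeroBSDAtTwo` (stmt-BirchSwinnertonDyer-22298):
# THE 2-RANK CERTIFICATE IS COMPLETE ON THE KILFORD SUB-CELL — the displayed bit of the RANK door, «some pair of consecutive layers of ℚ(e₁)'s
# cyclotomic ℤ₂-tower with equal 2-rank of the class group», is EQUIVALENT to `μ₂(ℚ(e₁)^{cyc}) = 0` (= H3M⁻ for that seed), kernel, no structure bit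

HONEST FRAMING (cell `bsd-f1-sign2`, WIDTH-5 attached prover seat `bsd-line-att-p5` gen 26 on line `birth` of the lead `bsd-line-att-p2`;
`--supports` stmt-BirchSwinnertonDyer-22298, closes nothing; BSD is NOT proved by any of this; the crux C2, its verdict «blocked-on
`Rank1Residual.GreenbergMuConjectureIrreducible`» and every registered stub are untouched). THEOREMS ONLY. REF1 §263 rider R263b in the kernel: cell
bsd-2adic's ★ `Fukuda.classicalMuVanishes_iff_exists_classGroupPRank_succ_eq` (`μ = 0 ⟺ ∃ m ≥ n₀, rank_p Cl(K_{m+1}) = rank_p Cl(K_m)`, for a `ℤ_p`-extension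
of Fukuda index `n₀`; Fukuda 1994 Thm. 1 (2) and its converse by monotonicity of `p`-ranks) composed with `n₀ = 0` on the Kilford sub-cell (three places above `2`
in `ℚ(β)`, each of index `1` — this seat's dictionary `…CubicKilfordPrimes` + att-p5 g25 `forall_totallyRamifiedFrom_zero_of_three_le_ncard`). So the RANK door
`…CubicKilfordPrimes.mazurMainConjecture_two_of_muIneqRel_of_onKilfordStratumAtTwo_of_classGroupPRank_succ_eq` loses nothing: its certificate is exactly
`μ₂(ℚ(β)^{cyc}) = 0`, the per-seed instance of H3M⁻ (att-p5 g24 `…CubicCarrierRoad`), while the ORDER certificate is never available there (att-p3 g25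
`…CubicTowerJumps`, this seat's `…CubicKilfordTowerGrowth`).

WHAT. **`classicalMuVanishes_iff_exists_classGroupPRank_succ_eq_seedCubicField_of_onKilfordStratumAtTwo`** (and its `Δ_min % 8 = 1` form, and the abstract
cubic-field form `…_of_three_le_ncard`): `W/ℚ` globally minimal, good ORDINARY at `2`, no rational `2`-torsion abscissa, ON the Kilford stratum, `β` a root of
`4x³ + b₂x² + 2b₄x + b₆`, `κP` a cyclotomic `ℤ₂`-extension of `ℚ(β)`: `μ(κP) = 0 ⟺ ∃ n, rank₂ Cl(ℚ(β)_{n+1}) = rank₂ Cl(ℚ(β)_n)`.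

Nothing is asserted about any seed's class groups; nothing is closed; BSD is not proved.

References: [Fukuda1994] Thm. 1 (2), p. 264; [Washington1997] §13.3 Lemma 13.15, Prop. 13.22–13.23; [NeukirchANT1999] Ch. II §8; tree: bsd-2adic
`Literature/NumberTheory/IwasawaTheory/NarrowFukudaRankMonotone.lean`, att-p5 g25 p743166, g26 p746875; REF1-AUDIT §263 R263b.
-/

set_option linter.dupNamespace false
set_option autoImplicit false

noncomputable section

open scoped Classical NumberField nonZeroDivisors

namespace Summit.BirchSwinnertonDyer.BirchSwinnertonDyer.Theorems.AlignedTransportAtTwoCubicKilfordRankCertificate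

open NumberField IsDedekindDomain Polynomial WeierstrassCurve IntermediateField
  Literature.NumberTheory.IwasawaTheory Literature.NumberTheory.GaloisRepresentations
  Literature.NumberTheory.EllipticCurves Literature.NumberTheory.EllipticCurves.Greenberg1999
  Summit.BirchSwinnertonDyer.Rank1Residual.F1Sign2
  Summit.BirchSwinnertonDyer.BirchSwinnertonDyer.Theorems.AlignedTransportAtTwoKilfordStratumShared
  Summit.BirchSwinnertonDyer.BirchSwinnertonDyer.Theorems.AlignedTransportAtTwoCubicLayerOneDoors
  Summit.BirchSwinnertonDyer.BirchSwinnertonDyer.Theorems.AlignedTransportAtTwoCubicKilfordPrimes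

/-- **The `2`-rank certificate is complete in a cubic field with three places above `2`**: for every cyclotomic `ℤ₂`-extension `κ` of such an `F`,
`μ(κ) = 0 ⟺ ∃ n, rank₂ Cl(F_{n+1}) = rank₂ Cl(F_n)` (Fukuda index `0` by parity; ★ of `NarrowFukudaRankMonotone`).
[cite: Fukuda1994, Thm. 1 (2), p. 264] [cite: Washington1997, §13.3 Prop. 13.22–13.23] -/
theorem classicalMuVanishes_iff_exists_classGroupPRank_succ_eq_of_three_le_ncard (F : Type) [Field F] [NumberField F]
    (hF : Module.finrank ℚ F = 3) (h3 : 3 ≤ {v : HeightOneSpectrum (𝓞 F) | ((2 : ℕ) : 𝓞 F) ∈ v.asIdeal}.ncard)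
    (κ : ZpExtension F 2) (hκ : κ.IsCyclotomic) :
    ClassicalMuVanishes κ ↔ ∃ n : ℕ, classGroupPRank κ (n + 1) = classGroupPRank κ n := by
  rw [Fukuda.classicalMuVanishes_iff_exists_classGroupPRank_succ_eq κ (forall_totallyRamifiedFrom_zero_of_three_le_ncard F hF h3 κ hκ)]
  exact ⟨fun ⟨m, _, hm⟩ => ⟨m, hm⟩, fun ⟨m, hm⟩ => ⟨m, Nat.zero_le m, hm⟩⟩

variable (W : WeierstrassCurve ℚ) [W.IsElliptic] [W.IsGloballyMinimal]

/-- **THE RANK DOOR'S CERTIFICATE IS EXACTLY `μ₂(ℚ(β)^{cyc}) = 0` ON THE KILFORD SUB-CELL — no structure bit.** `W/ℚ` globally minimal, good ORDINARY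
at `2`, no rational `2`-torsion abscissa, ON the Kilford stratum; `β ∈ ℚ̄` a root of the `2`-division cubic; `κP` a cyclotomic `ℤ₂`-extension of `ℚ(β)`:
`μ(κP) = 0 ⟺ ∃ n, rank₂ Cl(ℚ(β)_{n+1}) = rank₂ Cl(ℚ(β)_n)` — the displayed certificate `hcert` of
`…CubicKilfordPrimes.mazurMainConjecture_two_of_muIneqRel_of_onKilfordStratumAtTwo_of_classGroupPRank_succ_eq` is complete (REF1 §263 R263b in the kernel).
[cite: Fukuda1994, Thm. 1 (2), p. 264] [cite: Washington1997, §13.3 Prop. 13.22–13.23] [cite: NeukirchANT1999, Ch. II §8, (8.1)–(8.3)] -/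
theorem classicalMuVanishes_iff_exists_classGroupPRank_succ_eq_seedCubicField_of_onKilfordStratumAtTwo (hord : IsOrdinaryAt W 2)
    (ht : ∀ x : ℚ, ¬ HasRationalTwoTorsionX W x) (hs : OnKilfordStratumAtTwo W)
    {β : AlgebraicClosure ℚ} (hβ : aeval β W.twoTorsionPolynomial.toPoly = 0)
    (κP : ZpExtension ↥(IntermediateField.adjoin ℚ ({β} : Set (AlgebraicClosure ℚ))) 2) (hκP : κP.IsCyclotomic) :
    ClassicalMuVanishes κP ↔ ∃ n : ℕ, classGroupPRank κP (n + 1) = classGroupPRank κP n := by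
  have hirr := AlignedTransportAtTwoSeed.irr_two_of_forall_not_hasRationalTwoTorsionX W ht
  have hβint : IsIntegral ℚ β := ((AlgebraicClosure.isAlgebraic ℚ).isAlgebraic β).isIntegral
  haveI : FiniteDimensional ℚ ↥(IntermediateField.adjoin ℚ ({β} : Set (AlgebraicClosure ℚ))) :=
    IntermediateField.adjoin.finiteDimensional hβint
  haveI : NumberField ↥(IntermediateField.adjoin ℚ ({β} : Set (AlgebraicClosure ℚ))) := NumberField.mk
  have h3 : Module.finrank ℚ ↥(IntermediateField.adjoin ℚ ({β} : Set (AlgebraicClosure ℚ))) = 3 :=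
    AddKatoTwo.finrank_adjoin_root_twoTorsionPolynomial_eq_three W hirr hβ
  exact classicalMuVanishes_iff_exists_classGroupPRank_succ_eq_of_three_le_ncard _ h3
    (three_le_ncard_adjoin_root_twoTorsionPolynomial_of_onKilfordStratumAtTwo W hord ht hs hβ) κP hκP

/-- The same with the decidable hypothesis `Δ_min(W) % 8 = 1` (all twelve certified seeds). [cite: Fukuda1994, Thm. 1 (2), p. 264]
[cite: Serre1973, Ch. II §3.3 Thm. 4] -/
theorem classicalMuVanishes_iff_exists_classGroupPRank_succ_eq_seedCubicField_of_minimalDiscriminantInt_emod_eight (hord : IsOrdinaryAt W 2)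
    (ht : ∀ x : ℚ, ¬ HasRationalTwoTorsionX W x) (h8 : minimalDiscriminantInt W % 8 = 1)
    {β : AlgebraicClosure ℚ} (hβ : aeval β W.twoTorsionPolynomial.toPoly = 0)
    (κP : ZpExtension ↥(IntermediateField.adjoin ℚ ({β} : Set (AlgebraicClosure ℚ))) 2) (hκP : κP.IsCyclotomic) :
    ClassicalMuVanishes κP ↔ ∃ n : ℕ, classGroupPRank κP (n + 1) = classGroupPRank κP n :=
  classicalMuVanishes_iff_exists_classGroupPRank_succ_eq_seedCubicField_of_onKilfordStratumAtTwo W hord ht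
    ((onKilfordStratumAtTwo_iff_minimalDiscriminantInt_emod_eight W hord).mpr h8) hβ κP hκP

end Summit.BirchSwinnertonDyer.BirchSwinnertonDyer.Theorems.AlignedTransportAtTwoCubicKilfordRankCertificate

end
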